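import Mathlib
import HarnessLib
import Literature.Analysis.FluidPDE.SuitableWeak
import Literature.Analysis.FluidPDE.SelfSimilar
import Literature.Analysis.FluidPDE.LocalTypeI
import Literature.Analysis.FluidPDE.LocalTypeIReverseTools

/-!
# Scale-summed packing bound of the final-time singular set (line dissipation-quantum-tolerance,
# crux ApexLocalisation, stub `stub_packingSum`)

`stub_packingSum` (by-product of the dissipation quantum; pure accounting over the scaled
dissipation `cknE`, no PDE beyond invoking the quantum hypothesis). Work in the continuous
rate-Type-I class on the backward slab `𝕊 = slab ℝ³ (−∞, 0)`: suitable weak `(u, p)` with weak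
gradient `G`, `𝐈(ℝ³ × ℝ₋) ≤ I`, rate `C`, continuous on the open slab. HYPOTHESIS (the quantum,
landed separately): every final-slice singular point `(0, b)` of every class profile pays
`∫_{B(ρ, b)} |G|² ≥ e ρ` in the parabolic band `B(ρ, b) := Q((−ρ²/4, b), ρ/2) = (−ρ²/2, −ρ²/4) × B_{ρ/2}(b)`
at every scale `ρ > 0`. CLAIM: for a class profile, a centre `x₀`, `R > 0` and finite sets `S j` of
final-slice singular points in `B̄_R(x₀)` that are `R 2^{-j}`-separated,
`Σ_j 2^{-j} #S_j ≤ 2 I / e`.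

Proof: the bands `B(R/2^j, b)`, `b ∈ S j`, are pairwise disjoint (distinct scales differ by a factor
`≥ 2`, so their time windows are disjoint; equal scale `ρ` and distinct `b, b' ∈ S j` have
`dist b b' ≥ ρ = ρ/2 + ρ/2`, so the balls are disjoint), lie in `Q((0, x₀), 2R)` (`ρ ≤ R`,
`dist b x₀ + ρ/2 ≤ 3R/2 < 2R`) and pay `e R 2^{-j}` each (hypothesis applied to `u` itself). Summing
over the countable index `Σ j, S j` (`lintegral_iUnion`):
`e R · Σ_j 2^{-j} #S_j ≤ ∫_{Q((0,x₀),2R)} |G|² = 2R · E(Q((0,x₀),2R)) ≤ 2R · 𝐈 ≤ 2R · I`, and we divide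
by `e R`. [folklore]
-/

set_option linter.dupNamespace false

namespace Summit.NavierStokesRegularity.NavierStokesRegularity.Theorems.RellichScarApexLocalisation

open MeasureTheory Set Function Metric Filter Topology TopologicalSpace
open scoped ENNReal NNReal
open Literature.Analysis Literature.Analysis.FluidPDE

local notation "E³" => EuclideanSpace ℝ (Fin 3)

/-! ### Geometry of the dyadic parabolic bands `B(ρ, x) = Q((−ρ²/4, x), ρ/2)` -/

-- copied from …Theorems.RellichScarApexLocalisationQuantumAccounting, `two_mul_div_two_pow_le`
-- (module not yet built on the farm)
/-- **Dyadic scales are separated.** For `n < m`, `2 · c/2^m ≤ c/2^n` (`c ≥ 0`). -/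
private theorem packing_two_mul_div_two_pow_le {c : ℝ} (hc : 0 ≤ c) {n m : ℕ} (h : n < m) :
    2 * (c / 2 ^ m) ≤ c / 2 ^ n := by
  have h2 : (2 : ℝ) ^ (n + 1) ≤ 2 ^ m := pow_le_pow_right₀ (by norm_num) (Nat.succ_le_of_lt h)
  have h3 : c / 2 ^ m ≤ c / 2 ^ (n + 1) := div_le_div_of_nonneg_left hc (by positivity) h2
  calc 2 * (c / 2 ^ m) ≤ 2 * (c / 2 ^ (n + 1)) := by linarith
    _ = c / 2 ^ n := by rw [pow_succ]; field_simp

-- copied from …Theorems.RellichScarApexLocalisationQuantumAccounting,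
-- `disjoint_parabolicBand_of_two_mul_le` (module not yet built on the farm)
/-- **Different scales: disjoint time windows.** If `0 < ρ'` and `2ρ' ≤ ρ`, the bands
`B(ρ, x) = (−ρ²/2, −ρ²/4) × B_{ρ/2}(x)` and `B(ρ', y)` are disjoint: `−ρ'²/2 ≥ −ρ²/8 > −ρ²/4`. -/
private theorem packing_disjoint_band_of_two_mul_le {ρ ρ' : ℝ} (hρ' : 0 < ρ') (h : 2 * ρ' ≤ ρ)
    (x y : E³) :
    Disjoint (parabolicCylinder (ρ / 2) ((-(ρ ^ 2 / 4) : ℝ), x))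
      (parabolicCylinder (ρ' / 2) ((-(ρ' ^ 2 / 4) : ℝ), y)) := by
  refine Set.disjoint_left.2 fun w hw hw' => ?_
  simp only [mem_parabolicCylinder] at hw hw'
  have key : 4 * ρ' ^ 2 ≤ ρ ^ 2 := by nlinarith
  nlinarith [hw.1.2, hw'.1.1, sq_nonneg ρ']

-- copied from …Theorems.RellichScarApexLocalisationQuantumAccounting, `disjoint_dyadicBand_of_ne`
-- (module not yet built on the farm)
/-- **Dyadic bands of distinct indices are disjoint** (any centres): the scales `c/2^n`, `c/2^m`,
`n ≠ m`, differ by a factor `≥ 2`. -/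
private theorem packing_disjoint_dyadicBand_of_ne {c : ℝ} (hc : 0 < c) (x y : E³) {n m : ℕ}
    (hnm : n ≠ m) :
    Disjoint (parabolicCylinder (c / 2 ^ n / 2) ((-((c / 2 ^ n) ^ 2 / 4) : ℝ), x))
      (parabolicCylinder (c / 2 ^ m / 2) ((-((c / 2 ^ m) ^ 2 / 4) : ℝ), y)) := by
  rcases lt_or_gt_of_ne hnm with h | h
  · exact packing_disjoint_band_of_two_mul_le (by positivity)
      (packing_two_mul_div_two_pow_le hc.le h) x y
  · exact (packing_disjoint_band_of_two_mul_le (by positivity)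
      (packing_two_mul_div_two_pow_le hc.le h) y x).symm

/-- **Equal scale, separated centres: disjoint balls.** If `ρ ≤ dist x y`, the bands `B(ρ, x)` and
`B(ρ, y)` are disjoint (`ρ/2 + ρ/2 ≤ dist x y`, `Metric.ball_disjoint_ball`). -/
private theorem packing_disjoint_band_of_le_dist {ρ : ℝ} {x y : E³} (h : ρ ≤ dist x y) (t : ℝ) :
    Disjoint (parabolicCylinder (ρ / 2) (t, x)) (parabolicCylinder (ρ / 2) (t, y)) :=
  Set.disjoint_prod.2 (Or.inr (ball_disjoint_ball (by linarith)))

/-- **Bands inside the big cylinder.** If `0 < ρ ≤ R` and `dist x x₀ ≤ R`, then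
`B(ρ, x) ⊆ Q((0, x₀), 2R) = (−4R², 0) × B_{2R}(x₀)`. -/
private theorem packing_band_subset_cylinder {ρ R : ℝ} {x x₀ : E³} (hρ : 0 < ρ) (hρR : ρ ≤ R)
    (hx : dist x x₀ ≤ R) :
    parabolicCylinder (ρ / 2) ((-(ρ ^ 2 / 4) : ℝ), x) ⊆ parabolicCylinder (2 * R) ((0 : ℝ), x₀) := by
  intro w hw
  simp only [mem_parabolicCylinder] at hw ⊢
  have hρρ : ρ * ρ ≤ R * R := mul_le_mul hρR hρR hρ.le (hρ.le.trans hρR)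
  refine ⟨⟨by nlinarith [hw.1.1, mul_pos hρ hρ], by nlinarith [hw.1.2, sq_nonneg ρ]⟩, ?_⟩
  calc dist w.2 x₀ ≤ dist w.2 x + dist x x₀ := dist_triangle _ _ _
    _ < 2 * R := by linarith [hw.2]

/-! ### `ℝ≥0∞` bookkeeping -/

/-- **The quantum at a dyadic scale.** `ofReal (e · R/2^j) = ofReal (e R) · 2⁻¹^j` (`e, R ≥ 0`). -/
private theorem packing_ofReal_mul_div_two_pow {e R : ℝ} (he : 0 ≤ e) (hR : 0 ≤ R) (j : ℕ) :
    ENNReal.ofReal (e * (R / 2 ^ j)) = ENNReal.ofReal (e * R) * 2⁻¹ ^ j := by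
  rw [mul_div_assoc', div_eq_mul_inv, ENNReal.ofReal_mul (mul_nonneg he hR), ← inv_pow,
    ENNReal.ofReal_pow (by norm_num), ENNReal.ofReal_inv_of_pos (by norm_num),
    ENNReal.ofReal_ofNat]

/-- **Dividing the budget.** If `ofReal (e R) · T ≤ ofReal (2 R) · I` with `e, R > 0`, then
`T ≤ 2 I / ofReal e`. -/
private theorem packing_le_div_of_mul_le {e R : ℝ} (he : 0 < e) (hR : 0 < R) {T I : ℝ≥0∞}
    (h : ENNReal.ofReal (e * R) * T ≤ ENNReal.ofReal (2 * R) * I) :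
    T ≤ 2 * I / ENNReal.ofReal e := by
  have he0 : ENNReal.ofReal e ≠ 0 := (ENNReal.ofReal_pos.2 he).ne'
  have hR0 : ENNReal.ofReal R ≠ 0 := (ENNReal.ofReal_pos.2 hR).ne'
  have key : ENNReal.ofReal R * (T * ENNReal.ofReal e) ≤ ENNReal.ofReal R * (2 * I) := by
    calc ENNReal.ofReal R * (T * ENNReal.ofReal e) = ENNReal.ofReal (e * R) * T := by
          rw [ENNReal.ofReal_mul he.le]; ring
      _ ≤ ENNReal.ofReal (2 * R) * I := h
      _ = ENNReal.ofReal R * (2 * I) := by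
          rw [ENNReal.ofReal_mul (by norm_num : (0 : ℝ) ≤ 2), ENNReal.ofReal_ofNat]; ring
  rw [ENNReal.mul_le_mul_iff_right hR0 ENNReal.ofReal_ne_top] at key
  exact (ENNReal.le_div_iff_mul_le (Or.inl he0) (Or.inl ENNReal.ofReal_ne_top)).2 key

/-! ### The packing bound -/

/-- **BY-PRODUCT, SCALE-SUMMED PACKING BOUND for the final-time singular set** (pure accounting given the
dissipation quantum): if `e > 0` is a band quantum for the final-slice singular points of every continuous
class-`(C,I)` profile at every scale, then for a continuous class-`(C,I)` profile, a centre `x₀`, a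
radius `R > 0` and finite sets `S_j` of final-slice singular points in `B̄_R(x₀)` that are
`R 2^{-j}`-separated, `Σ_j 2^{-j} #S_j ≤ 2I/e`: the bands of scale `R 2^{-j}` at the points of `S_j` are
pairwise disjoint across points (ball separation) AND scales (time windows), lie in `Q((0,x₀),2R)`, and
pay `e R 2^{-j}` each, against the budget `∫_{Q((0,x₀),2R)} |∇u|² ≤ 2R·𝐈 ≤ 2R I`. [folklore] -/
theorem stub_packingSum :
    ∀ (C : ℝ) (I : ℝ≥0∞) (e : ℝ), 0 < e →
      (∀ (v : ℝ → E³ → E³) (q : ℝ → E³ → ℝ) (H : ℝ → E³ → E³ →L[ℝ] E³),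
        IsSuitableWeakSolutionOn (slab E³ (Iio 0) isOpen_Iio) 1 0 v q →
        HasWeakSpatialGradientOn (slab E³ (Iio 0) isOpen_Iio) v H →
        typeIBound (Iio (0 : ℝ) ×ˢ univ) v q H ≤ I →
        HasTypeITimeDecay C v →
        ContinuousOn (uncurry v) (Iio (0 : ℝ) ×ˢ univ) →
        ∀ b : E³, IsBackwardSingularPoint v ((0 : ℝ), b) →
        ∀ ρ : ℝ, 0 < ρ → ENNReal.ofReal (e * ρ) ≤
          ∫⁻ z in parabolicCylinder (ρ / 2) ((-(ρ ^ 2 / 4) : ℝ), b),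
            ENNReal.ofReal (frobeniusNormSq (H z.1 z.2))) →
      ∀ (u : ℝ → E³ → E³) (p : ℝ → E³ → ℝ) (G : ℝ → E³ → E³ →L[ℝ] E³),
        IsSuitableWeakSolutionOn (slab E³ (Iio 0) isOpen_Iio) 1 0 u p →
        HasWeakSpatialGradientOn (slab E³ (Iio 0) isOpen_Iio) u G →
        typeIBound (Iio (0 : ℝ) ×ˢ univ) u p G ≤ I →
        HasTypeITimeDecay C u →
        ContinuousOn (uncurry u) (Iio (0 : ℝ) ×ˢ univ) →
        ∀ (x₀ : E³) (R : ℝ), 0 < R → ∀ S : ℕ → Finset E³,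
          (∀ j : ℕ, ∀ b ∈ S j, IsBackwardSingularPoint u ((0 : ℝ), b) ∧ dist b x₀ ≤ R) →
          (∀ j : ℕ, (↑(S j) : Set E³).Pairwise fun b b' => R * 2⁻¹ ^ j ≤ dist b b') →
          ∑' j : ℕ, (2⁻¹ : ℝ≥0∞) ^ j * ((S j).card : ℝ≥0∞) ≤ 2 * I / ENNReal.ofReal e := by
  intro C I e he hq u p G hu hG hI hC hcont x₀ R hR S hS hsep
  -- the quantum hypothesis applied to the class profile `u` itself
  have hpay : ∀ b : E³, IsBackwardSingularPoint u ((0 : ℝ), b) → ∀ ρ : ℝ, 0 < ρ →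
      ENNReal.ofReal (e * ρ) ≤ ∫⁻ z in parabolicCylinder (ρ / 2) ((-(ρ ^ 2 / 4) : ℝ), b),
        ENNReal.ofReal (frobeniusNormSq (G z.1 z.2)) := hq u p G hu hG hI hC hcont
  refine packing_le_div_of_mul_le he hR ?_
  -- the integrand and the bands `N ⟨j, b⟩ = B(R/2^j, b)`, `b ∈ S j`
  set F : ℝ × E³ → ℝ≥0∞ := fun z => ENNReal.ofReal (frobeniusNormSq (G z.1 z.2)) with hF
  set N : (Σ j : ℕ, {b : E³ // b ∈ S j}) → Set (ℝ × E³) := fun i =>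
    parabolicCylinder (R / 2 ^ i.1 / 2) ((-((R / 2 ^ i.1) ^ 2 / 4) : ℝ), (i.2 : E³)) with hN
  -- scale facts
  have hσle : ∀ j : ℕ, R / 2 ^ j ≤ R := fun j => div_le_self hR.le (one_le_pow₀ (by norm_num))
  have hσeq : ∀ j : ℕ, R * 2⁻¹ ^ j = R / 2 ^ j := fun j => by rw [inv_pow, div_eq_mul_inv]
  -- measurability, disjointness, inclusion of the bands
  have hNm : ∀ i, MeasurableSet (N i) := fun i => (isOpen_parabolicCylinder _ _).measurableSet
  have hNd : Pairwise (Disjoint on N) := by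
    rintro ⟨j, b, hb⟩ ⟨j', b', hb'⟩ hne
    rcases eq_or_ne j j' with rfl | hjj'
    · have hbb' : b ≠ b' := fun h => hne (by subst h; rfl)
      have hd : R / 2 ^ j ≤ dist b b' := (hσeq j) ▸ hsep j hb hb' hbb'
      exact packing_disjoint_band_of_le_dist hd _
    · exact packing_disjoint_dyadicBand_of_ne hR b b' hjj'
  have hNQ : (⋃ i, N i) ⊆ parabolicCylinder (2 * R) ((0 : ℝ), x₀) :=
    iUnion_subset fun i => packing_band_subset_cylinder (by positivity) (hσle i.1)
      (hS i.1 i.2 i.2.2).2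
  -- the budget `∫_{Q((0,x₀),2R)} F ≤ 2R · I`
  have hc : 0 < 2 * R := by positivity
  have hQ : parabolicCylinder (2 * R) ((0 : ℝ), x₀) ⊆ Iio (0 : ℝ) ×ˢ (univ : Set E³) :=
    parabolicCylinder_subset_lowerHalf le_rfl (2 * R)
  have hE : cknE (2 * R) ((0 : ℝ), x₀) G ≤ I :=
    ((cknE_le_abScaledSum (u := u) (p := p)).trans (abScaledSum_le_typeIBound hc hQ)).trans hI
  have hbudget : ∫⁻ z in parabolicCylinder (2 * R) ((0 : ℝ), x₀), F z ≤
      ENNReal.ofReal (2 * R) * I := by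
    have h0 : ENNReal.ofReal (2 * R) ≠ 0 := (ENNReal.ofReal_pos.2 hc).ne'
    calc ∫⁻ z in parabolicCylinder (2 * R) ((0 : ℝ), x₀), F z
          = ENNReal.ofReal (2 * R) * cknE (2 * R) ((0 : ℝ), x₀) G := by
            rw [cknE, ← mul_assoc, ENNReal.mul_inv_cancel h0 ENNReal.ofReal_ne_top, one_mul]
      _ ≤ ENNReal.ofReal (2 * R) * I := by gcongr
  -- the sum of the quanta
  have hsum : ∑' i : (Σ j : ℕ, {b : E³ // b ∈ S j}), ENNReal.ofReal (e * (R / 2 ^ i.1)) =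
      ENNReal.ofReal (e * R) * ∑' j : ℕ, (2⁻¹ : ℝ≥0∞) ^ j * ((S j).card : ℝ≥0∞) := by
    rw [ENNReal.tsum_sigma', ← ENNReal.tsum_mul_left]
    refine tsum_congr fun j => ?_
    show ∑' _ : {b : E³ // b ∈ S j}, ENNReal.ofReal (e * (R / 2 ^ j)) = _
    rw [ENNReal.tsum_const, ENat.card_eq_coe_fintype_card, Fintype.card_coe,
      packing_ofReal_mul_div_two_pow he.le hR.le j]
    push_cast
    ring
  calc ENNReal.ofReal (e * R) * ∑' j : ℕ, (2⁻¹ : ℝ≥0∞) ^ j * ((S j).card : ℝ≥0∞)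
        = ∑' i : (Σ j : ℕ, {b : E³ // b ∈ S j}), ENNReal.ofReal (e * (R / 2 ^ i.1)) := hsum.symm
    _ ≤ ∑' i : (Σ j : ℕ, {b : E³ // b ∈ S j}), ∫⁻ z in N i, F z :=
        ENNReal.tsum_le_tsum fun i => hpay i.2 (hS i.1 i.2 i.2.2).1 _ (by positivity)
    _ = ∫⁻ z in ⋃ i, N i, F z := (lintegral_iUnion hNm hNd F).symm
    _ ≤ ∫⁻ z in parabolicCylinder (2 * R) ((0 : ℝ), x₀), F z := lintegral_mono_set hNQ
    _ ≤ ENNReal.ofReal (2 * R) * I := hbudget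

end Summit.NavierStokesRegularity.NavierStokesRegularity.Theorems.RellichScarApexLocalisation
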